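import Literature.Analysis.FunctionSpaces.PVDefinability
import Literature.Computability.MetaComplexity.BoundedArithS2SuccIND
import HarnessLib

/-!
# `T₂ⁱ(PV) ⊆ S₂ⁱ⁺¹(PV)`: `Σᵇᵢ(PV)`-induction in models of `S₂ⁱ⁺¹(PV)`

Sibling proof file of `PVTheory.lean`: we discharge its named fact
`Literature.Analysis.FunctionSpaces.T2PV_extends_to_S2PV_succ` — "`S₂ⁱ⁺¹(PV)` proves every axiom
of `T₂ⁱ(PV)`", i.e. the `Σᵇᵢ₊₁(PV)-PIND` axioms imply the `Σᵇᵢ(PV)-IND` axioms over `BASIC` (and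
the defining axioms of the `PV` symbols) (Buss 1986, Cor. 2.16 relativised to `L(PV)`, Ch. 6;
Buss 1990, §1, p. 3: "the `Σᵇᵢ₊₁-PIND` axioms imply the `Σᵇᵢ-IND` axioms. Hence the theory `S₂ⁱ⁺¹`
contains `T₂ⁱ`"; Krajíček 1995, Lemma 5.2.8, p. 68: `T₂ⁱ ⊆ S₂ⁱ⁺¹`, and §5.3, p. 73 for the
relativisation to the language of `PV`) — for every `i ≥ 0`, semantically (provability is
Mathlib's `⊨ᵇ`).

This is the `L(PV)` twin of `Literature/Computability/MetaComplexity/BoundedArithS2SuccIND.lean`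
(the same theorem for Buss's original language, `T2_extends_S2_succ_holds`), and it *reuses* that
development instead of re-running the bootstrapping: an `L(PV)`-structure `M` carries the
`L(S₂)`-reduct `pvReduct M` (`PVDefinability.lean`), a model of `S₂ⁱ⁺¹(PV)` is on the reduct a
model of `BASIC` (`model_BASIC_of_model_S2PV`) and of Buss's `Σᵇⱼ-PIND` for every `j ≤ i + 1`
(`model_PINDScheme_of_model_S2PV`: the translation of a `Σᵇⱼ` formula is `Σᵇⱼ(PV)`), so the whole
algebraic toolkit `BASICModel` (order, semiring notation, `|·|`, `#`, Krajíček's powers of two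
`IsPow`, halving of powers of two, `1 # y` is a power of two) applies verbatim.  What has to be
redone is only the part that mentions the induction formula `A`, which is now a `Σᵇᵢ(PV)` formula
with parameters and hence not `L(S₂)`-definable: the `Σᵇᵢ₊₁(PV)`-definability of the search
predicate of the binary search and the search itself, by `Σᵇᵢ₊₁(PV)-PIND`
(`IsSigmabPVDef.pinduction'` of `PVDefinability.lean`).

## The argument (as in `BoundedArithS2SuccIND.lean`)

Suppose `A(0)`, `∀x (A(x) → A(x+1))` and `¬A(a)`, and put `A'(x) :≡ x ≤ a ∧ A(x)`.  By
`Σᵇᵢ₊₁(PV)-PIND` on `c` one proves `|c| ≤ |a| + 1 → D(c)` for the `Σᵇᵢ₊₁(PV)` formula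

  `D(c) :≡ ∃m ≤ a ∃q ≤ 1#(2a+1) [Pow(q) ∧ |q| + |c| = |a| + 2 ∧ A'(m·q) ∧ ¬A'(m·q + q)]`:

for `c = 0` take `m = 0`, `q = 1#(2a+1) = 2^{|a|+1} > a`; in the induction step the power of two is
halved and `m` becomes `2m + 1` or `2m` according as `A'((2m+1)·⌊q/2⌋)` holds or not.  At
`c = 2a + 1` we get `q = 1`, i.e. `A'(m) ∧ ¬A'(m + 1)` with `m ≤ a`, contradicting the induction
step of `A`.  (Krajíček's "shortening of cuts", loc. cit., arranged dyadically so that only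
`BASIC` is used — no subtraction, no `MSP`, no sequence coding.)

## Main statements

* `model_BASIC_of_model_S2PV`, `model_PINDScheme_of_model_S2PV`: transfer to the reduct;
* `ind_of_model_S2PV_succ`: **`Σᵇᵢ(PV)-IND` in models of `S₂ⁱ⁺¹(PV)`**;
* `model_T2PV_of_model_S2PV_succ`: a model of `S₂ⁱ⁺¹(PV)` is a model of `T₂ⁱ(PV)`;
* `T2PV_extends_to_S2PV_succ_holds`: discharge of `T2PV_extends_to_S2PV_succ`.

## References

* S. R. Buss, *Bounded Arithmetic*, Bibliopolis 1986, §2.6 (Cor. 2.16), Ch. 6 (`S₂ⁱ(PV)`).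
* S. R. Buss, *Axiomatizations and conservation results for fragments of bounded arithmetic*,
  in: Logic and Computation, Contemp. Math. 106, AMS 1990, pp. 57–84, §1 (p. 3).
* J. Krajíček, *Bounded Arithmetic, Propositional Logic and Complexity Theory*, CUP 1995,
  Lemma 5.2.8 (p. 68); §5.3 (p. 73: `S₂¹(PV)`).

## Design choices

* Everything is proved in an arbitrary `L(PV)`-structure `M ⊨ S₂ʲ⁺¹(PV)` with the reduct
  `pvReduct M` as a *local* instance and the instance argument `[M ⊨ BASIC]` (on the reduct) for
  the algebraic notation of `BASICModel`; the final statements do not mention the reduct.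
* The case `j = 0` (`T₂⁰(PV) ⊆ S₂¹(PV)`) is included: the argument is uniform in `j`.
-/

namespace Literature.Analysis.FunctionSpaces

open FirstOrder FirstOrder.Language
open Literature.Computability.MetaComplexity (BASIC PINDScheme sigmabFormulas IsSigmab
  realize_pindAxiom_iff mZero mSucc mHalf mLen mAdd mMul mSmash MLe)

attribute [local instance] pvReduct isExpansionOn_pvReduct

/-! ## Transfer to the `L(S₂)`-reduct -/

section Transfer

variable {M : Type} [Language.pv.Structure M] {i : ℕ}

/-- A model of `S₂ⁱ(PV)` is, on its `L(S₂)`-reduct, a model of `BASIC` (`S₂ⁱ(PV)` contains the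
translated `BASIC`; Buss 1986, Ch. 6).  (The `T₂ⁱ(PV)` analogue is `model_BASIC_of_model_T2PV` of
`PVTheoryPINDProofs.lean`.) [cite: Buss1986, Ch. 6] -/
theorem model_BASIC_of_model_S2PV (hM : M ⊨ S2PV i) : M ⊨ BASIC :=
  (model_onTheory_boundedArithToPV_iff' BASIC).1 (hM.mono (onTheory_BASIC_subset_S2PV i))

/-- **Buss's `Σᵇⱼ-PIND` on the reduct of a model of `S₂ⁱ(PV)`**, `j ≤ i`: the translation of a
`Σᵇⱼ` formula of `L(S₂)` is a `Σᵇⱼ(PV) ⊆ Σᵇᵢ(PV)` formula (`IsSigmab.onBoundedFormula`), its `PIND`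
axiom over `L(PV)` is an axiom of `S₂ⁱ(PV)`, and both axioms say the same about `M`
(Buss 1986, Ch. 6: `S₂ⁱ ⊆ S₂ⁱ(PV)`). [cite: Buss1986, Ch. 6] -/
theorem model_PINDScheme_of_model_S2PV (hM : M ⊨ S2PV i) {j : ℕ} (hj : j ≤ i) :
    M ⊨ PINDScheme (sigmabFormulas j) := by
  refine ⟨fun σ hσ => ?_⟩
  simp only [PINDScheme, Set.mem_iUnion, Set.mem_image] at hσ
  obtain ⟨k, ψ, hψ, rfl⟩ := hσ
  have hψ' : IsSigmabPV i (boundedArithToPV.onFormula ψ) :=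
    IsSigmabPV.mono_holds hj (IsSigmab.onBoundedFormula hψ)
  have hax := (realize_pvPindAxiom_iff (boundedArithToPV.onFormula ψ)).1
    (hM.realize_of_mem _ (pvPindAxiom_mem_S2PV hψ'))
  simp only [realize_onFormula_boundedArithToPV'] at hax
  exact (realize_pindAxiom_iff ψ).2 hax

end Transfer

/-! ## `Σᵇⱼ(PV)`-induction from `Σᵇⱼ₊₁(PV)`-polynomial induction -/

section Bisection

open Literature.Computability.MetaComplexity.BASICModel

variable {M : Type} [Language.pv.Structure M] [hB : M ⊨ BASIC]

/-! ### Definability bookkeeping in algebraic notation -/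

/-- `1 = S0` is a term function over `L(PV)` (algebraic notation). [folklore] -/
theorem isPVTermFn_one {m : ℕ} : IsPVTermFn fun _ : Fin m → M => (1 : M) :=
  IsPVTermFn.zero.succ

/-- Krajíček's predicate `IsPow` ("power of two": `∃x ≤ a (x + 1 = a ∧ |x| + 1 = |a|)`,
Krajíček 1995, p. 75) is `Σᵇ₁(PV)`-definable with parameters, as a bounded `∃` of an open
formula (the `L(PV)` form of `isSigmabDef_isPow`). [cite: Krajicek1995, p. 75] -/
theorem isSigmabPVDef_isPow : IsSigmabPVDef 1 fun v : Fin 1 → M => IsPow (v 0) := by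
  refine (IsSigmabPVDef.bexLE (i := 0)
    (R := fun w : Fin 2 → M => w 1 + 1 = w 0 ∧ mLen (w 1) + 1 = mLen (w 0))
    (((IsQFPVDef.eq ((IsPVTermFn.proj 1).add isPVTermFn_one) (IsPVTermFn.proj 0)).and
      (IsQFPVDef.eq ((IsPVTermFn.proj 1).len.add isPVTermFn_one)
        (IsPVTermFn.proj 0).len)).isSigmabPVDef 1) (IsPVTermFn.proj 0)).of_iff fun v => ?_
  simp [IsPow]

/-- The search predicate of the binary search is `Σᵇⱼ₊₁(PV)`-definable with parameters: for
`A ∈ Σᵇⱼ(PV)` (with parameters) and parameters `a, Q, L`,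
`D(c) :≡ ∃m ≤ a ∃q ≤ Q [Pow(q) ∧ |q| + |c| = L ∧ (m·q ≤ a ∧ A(m·q)) ∧ ¬(m·q + q ≤ a ∧ A(m·q + q))]`
is `Σᵇⱼ₊₁(PV)` (the last conjunct being the negation of a `Πᵇⱼ₊₁(PV)` formula; Buss 1986, §2.1,
Ch. 6). [cite: Buss1986, §2.1] -/
theorem isSigmabPVDef_bisect {j : ℕ} {A : M → Prop}
    (hA : IsSigmabPVDef j fun v : Fin 1 → M => A (v 0)) (a Q L : M) :
    IsSigmabPVDef (j + 1) fun v : Fin 1 → M =>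
      ∃ m, m ≤ a ∧ ∃ q, q ≤ Q ∧ (IsPow q ∧ mLen q + mLen (v 0) = L ∧
        ((m * q ≤ a ∧ A (m * q)) ∧ ¬(m * q + q ≤ a ∧ A (m * q + q)))) := by
  have hle : IsQFPVDef fun v : Fin 1 → M => v 0 ≤ a :=
    IsQFPVDef.le (IsPVTermFn.proj 0) (IsPVTermFn.const a)
  have hA' : IsSigmabPVDef (j + 1) fun v : Fin 1 → M => v 0 ≤ a ∧ A (v 0) :=
    (hle.isSigmabPVDef (j + 1)).and (hA.mono (Nat.le_succ j))
  have hnA' : IsSigmabPVDef (j + 1) fun v : Fin 1 → M => ¬(v 0 ≤ a ∧ A (v 0)) :=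
    ((hle.isPibPVDef (j + 1)).and hA.isPibPVDef_succ).not
  have h3 : IsSigmabPVDef (j + 1) fun u : Fin 3 → M =>
      IsPow (u 2) ∧ mLen (u 2) + mLen (u 0) = L ∧
        ((u 1 * u 2 ≤ a ∧ A (u 1 * u 2)) ∧ ¬(u 1 * u 2 + u 2 ≤ a ∧ A (u 1 * u 2 + u 2))) :=
    ((isSigmabPVDef_isPow.comp₁ (IsPVTermFn.proj 2)).mono (Nat.succ_le_succ (Nat.zero_le j))).and
      (((IsQFPVDef.eq ((IsPVTermFn.proj 2).len.add (IsPVTermFn.proj 0).len)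
          (IsPVTermFn.const L)).isSigmabPVDef (j + 1)).and
        ((hA'.comp₁ (P := fun x => x ≤ a ∧ A x)
            ((IsPVTermFn.proj 1).mul (IsPVTermFn.proj 2))).and
          (hnA'.comp₁ (P := fun x => ¬(x ≤ a ∧ A x))
            (((IsPVTermFn.proj 1).mul (IsPVTermFn.proj 2)).add (IsPVTermFn.proj 2)))))
  have h2 : IsSigmabPVDef (j + 1) fun w : Fin 2 → M =>
      ∃ q, q ≤ Q ∧ (IsPow q ∧ mLen q + mLen (w 0) = L ∧
        ((w 1 * q ≤ a ∧ A (w 1 * q)) ∧ ¬(w 1 * q + q ≤ a ∧ A (w 1 * q + q)))) :=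
    (IsSigmabPVDef.bexLE (i := j) h3 (IsPVTermFn.const Q)).of_iff fun w => by simp
  exact (IsSigmabPVDef.bexLE (i := j) h2 (IsPVTermFn.const a)).of_iff fun v => by simp

/-- **`Σᵇⱼ(PV)-IND` in models of `S₂ʲ⁺¹(PV)`** (`T₂ʲ(PV) ⊆ S₂ʲ⁺¹(PV)`: Buss 1986, Cor. 2.16 and
Ch. 6; Buss 1990, §1, p. 3; Krajíček 1995, Lemma 5.2.8 with §5.3): if `A ⊆ M` is
`Σᵇⱼ(PV)`-definable with parameters, `A(0)` and `∀x (A(x) → A(x + 1))`, then `A = M`.  Proof: the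
dyadic binary search of the module docstring — `Σᵇⱼ₊₁(PV)-PIND` on `c` for `|c| ≤ |a| + 1 → D(c)`
with `D` as in `isSigmabPVDef_bisect` (`Q = 1#(2a+1)`, `L = |a| + 2`), then `c = 2a + 1`; the
power of two `1#(2a+1)` comes from Buss's `Σᵇ₁-PIND` on the reduct
(`model_PINDScheme_of_model_S2PV`). [cite: Krajicek1995, Lemma 5.2.8 (p. 68)] -/
theorem ind_of_model_S2PV_succ' {j : ℕ} (hM : M ⊨ S2PV (j + 1)) {A : M → Prop}
    (hA : IsSigmabPVDef j fun v : Fin 1 → M => A (v 0)) (h0 : A 0) (hs : ∀ x, A x → A (x + 1))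
    (a : M) : A a := by
  by_contra hna
  have hP : M ⊨ ⋃ k, pvPindAxiom '' sigmabPVFormulas (j + 1) k :=
    hM.mono Set.subset_union_right
  have hP1 : M ⊨ PINDScheme (sigmabFormulas 1) :=
    model_PINDScheme_of_model_S2PV hM (Nat.succ_le_succ (Nat.zero_le j))
  -- the bound `Q = 1 # (2a + 1) = 2^{|a| + 1} > a`
  have hQpow : IsPow (mSmash 1 (2 * a + 1)) := isPow_one_mSmash hP1 _
  have hQlen : mLen (mSmash 1 (2 * a + 1)) = mLen a + 1 + 1 := by
    rw [mLen_one_mSmash, mLen_two_mul_add_one]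
  have haQ : a < mSmash 1 (2 * a + 1) :=
    lt_of_mLen_lt_mLen (by rw [hQlen]; exact (lt_add_one' _).trans_le (le_add_right'' _ _))
  -- the binary search
  have key : ∀ c, mLen c ≤ mLen a + 1 →
      ∃ m, m ≤ a ∧ ∃ q, q ≤ mSmash 1 (2 * a + 1) ∧ (IsPow q ∧ mLen q + mLen c = mLen a + 1 + 1 ∧
        ((m * q ≤ a ∧ A (m * q)) ∧ ¬(m * q + q ≤ a ∧ A (m * q + q)))) := by
    intro c
    refine IsSigmabPVDef.pinduction' hP
      (P := fun c => mLen c ≤ mLen a + 1 →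
        ∃ m, m ≤ a ∧ ∃ q, q ≤ mSmash 1 (2 * a + 1) ∧ (IsPow q ∧ mLen q + mLen c = mLen a + 1 + 1 ∧
          ((m * q ≤ a ∧ A (m * q)) ∧ ¬(m * q + q ≤ a ∧ A (m * q + q)))))
      (IsSigmabPVDef.imp ((IsQFPVDef.le (IsPVTermFn.proj 0).len
        (IsPVTermFn.const (mLen a + 1))).isPibPVDef (j + 1)) (isSigmabPVDef_bisect hA a _ _))
      ?_ ?_ c
    · -- `c = 0`: `m = 0`, `q = Q`
      intro _
      refine ⟨0, bot_le, mSmash 1 (2 * a + 1), le_rfl, hQpow, ?_, ?_, ?_⟩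
      · rw [mZero_eq, mLen_zero, add_zero, hQlen]
      · rw [zero_mul]
        exact ⟨bot_le, h0⟩
      · rw [zero_mul, zero_add]
        exact fun h => haQ.not_ge h.1
    · -- `⌊c/2⌋ ↦ c`: halve `q`, refine `m`
      intro c ih hc
      rcases eq_or_ne c 0 with rfl | hc0
      · rw [mHalf_zero] at ih
        exact ih hc
      have hlen : mLen c = mLen (mHalf c) + 1 := mLen_eq_mLen_mHalf_add_one hc0
      have hc' : mLen (mHalf c) ≤ mLen a := by
        rw [hlen] at hc
        exact le_of_add_le_add_right hc
      obtain ⟨m, -, q, hqQ, hq, hql, hAm, hnAm⟩ := ih (hc'.trans (le_add_right'' _ _))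
      have hq1 : q ≠ 1 := by
        rintro rfl
        rw [mLen_one, add_comm (1 : M)] at hql
        have h' : mLen (mHalf c) = mLen a + 1 := add_right_cancel hql
        rw [h'] at hc'
        exact (lt_add_one' _).not_ge hc'
      obtain ⟨hqe, hq'⟩ := hq.eq_two_mul_mHalf hq1
      have hq'0 : mHalf q ≠ 0 := hq'.ne_zero
      have hqq : q = mHalf q + mHalf q := by rw [← two_mul]; exact hqe
      have hql' : mLen (mHalf q) + mLen c = mLen a + 1 + 1 := by
        rw [← hql, hlen]
        conv_rhs => rw [hqe, mLen_two_mul hq'0]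
        rw [add_assoc, add_comm (mLen (mHalf c)) 1]
      have e0 : (m + m) * mHalf q = m * q := by rw [add_mul, ← mul_add, ← hqq]
      have e1 : (m + m + 1) * mHalf q = m * q + mHalf q := by rw [add_mul, e0, one_mul]
      have e1' : (m + m) * mHalf q + mHalf q = (m + m + 1) * mHalf q := by
        rw [add_mul (m + m) 1, one_mul]
      have e2 : (m + m + 1) * mHalf q + mHalf q = m * q + q := by rw [e1, add_assoc, ← hqq]
      have hq'Q : mHalf q ≤ mSmash 1 (2 * a + 1) := (mHalf_le q).trans hqQ
      have hle : ∀ n : M, n ≤ n * mHalf q := fun n => by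
        simpa using mul_le_mul'' (le_refl n) ((one_le_iff_ne_zero' _).2 hq'0)
      by_cases hmid : (m + m + 1) * mHalf q ≤ a ∧ A ((m + m + 1) * mHalf q)
      · refine ⟨m + m + 1, (hle _).trans hmid.1, mHalf q, hq'Q, hq', hql', hmid, ?_⟩
        rw [e2]
        exact hnAm
      · refine ⟨m + m, (hle _).trans ?_, mHalf q, hq'Q, hq', hql', ?_, ?_⟩
        · rw [e0]
          exact hAm.1
        · rw [e0]
          exact hAm
        · rw [e1']
          exact hmid
  -- conclusion at `c = 2a + 1`
  obtain ⟨m, -, q, -, hq, hql, hAm, hnAm⟩ := key (2 * a + 1) (by rw [mLen_two_mul_add_one])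
  rw [mLen_two_mul_add_one, add_comm (mLen q)] at hql
  have hq1 : q = 1 := hq.eq_one_of_mLen_eq_one (add_left_cancel hql)
  subst hq1
  rw [mul_one] at hAm hnAm
  have hm1 : ¬(m + 1 ≤ a) := fun h => hnAm ⟨h, hs m hAm.2⟩
  have hma : a ≤ m := (lt_add_one_iff' a m).1 (not_le.1 hm1)
  exact hna (le_antisymm hAm.1 hma ▸ hAm.2)

end Bisection

/-! ## Models of `S₂ʲ⁺¹(PV)` are models of `T₂ʲ(PV)` -/

section Models

open Literature.Computability.MetaComplexity.BASICModel

variable {M : Type} [Language.pv.Structure M] {j : ℕ}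

/-- **`Σᵇⱼ(PV)-IND` in models of `S₂ʲ⁺¹(PV)`**: in a model of `S₂ʲ⁺¹(PV)`, induction holds for
every predicate `Σᵇⱼ(PV)`-definable with parameters (Buss 1986, Cor. 2.16, Ch. 6; Buss 1990, §1,
p. 3; Krajíček 1995, Lemma 5.2.8, §5.3). [cite: BussContempMath1990, §1 (p. 3)] -/
theorem ind_of_model_S2PV_succ (hM : M ⊨ S2PV (j + 1)) {A : M → Prop}
    (hA : IsSigmabPVDef j fun v : Fin 1 → M => A (v 0)) (h0 : A (mZero M))
    (hs : ∀ x, A x → A (mSucc x)) (a : M) : A a := by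
  haveI : M ⊨ BASIC := model_BASIC_of_model_S2PV hM
  exact ind_of_model_S2PV_succ' hM hA h0 (fun x hx => by rw [← mSucc_eq]; exact hs x hx) a

/-- **A model of `S₂ʲ⁺¹(PV)` is a model of `T₂ʲ(PV)`** (`T₂ʲ(PV) ⊆ S₂ʲ⁺¹(PV)`; Buss 1986,
Cor. 2.16, Ch. 6; Krajíček 1995, Lemma 5.2.8, §5.3): it satisfies the translated `BASIC`, the
defining axioms `PVdef`, and, by `ind_of_model_S2PV_succ`, every `Σᵇⱼ(PV)-IND` axiom.
[cite: Krajicek1995, Lemma 5.2.8 (p. 68)] -/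
theorem model_T2PV_of_model_S2PV_succ (hM : M ⊨ S2PV (j + 1)) : M ⊨ T2PV j := by
  refine ⟨fun φ hφ => ?_⟩
  rcases hφ with (hφ | hφ) | hφ
  · exact hM.realize_of_mem φ (onTheory_BASIC_subset_S2PV _ hφ)
  · exact hM.realize_of_mem φ (PVdef_subset_S2PV _ hφ)
  · simp only [Set.mem_iUnion, Set.mem_image] at hφ
    obtain ⟨k, ψ, hψ, rfl⟩ := hφ
    rw [realize_pvIndAxiom_iff]
    intro p h0 hs a
    exact ind_of_model_S2PV_succ hM (hψ.isSigmabPVDef_realize_snoc p) h0 hs a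

end Models

/-- **Discharge of `T2PV_extends_to_S2PV_succ`**: for every `i`, `S₂ⁱ⁺¹(PV)` extends `T₂ⁱ(PV)` —
every axiom of `T₂ⁱ(PV)` (translated `BASIC`, `PVdef`, and the `Σᵇᵢ(PV)-IND` axioms) is a
consequence (`⊨ᵇ`) of `S₂ⁱ⁺¹(PV)` (Buss 1986, Cor. 2.16 relativised to `L(PV)`, Ch. 6; Buss 1990,
§1, p. 3; Krajíček 1995, Lemma 5.2.8 (p. 68) with §5.3 (p. 73)).
[cite: Krajicek1995, Lemma 5.2.8 (p. 68)] -/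
theorem T2PV_extends_to_S2PV_succ_holds : T2PV_extends_to_S2PV_succ := by
  intro j φ hφ
  rw [Theory.models_sentence_iff]
  intro N
  haveI : (N : Type) ⊨ T2PV j := model_T2PV_of_model_S2PV_succ N.is_model
  exact Theory.realize_sentence_of_mem (T2PV j) hφ

end Literature.Analysis.FunctionSpaces
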